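import Summits.AnomalousDissipation.AnomalousDissipation.Theorems.BaireTransferRobustLoudUpgradeLineScalingDefs
import Summits.AnomalousDissipation.AnomalousDissipation.Theorems.BaireTransferRobustLoudUpgradeStubScalingLoud

/-!
# Line `malkin-cone-group-orbits`, COMPANION skeleton c4 (lead `…-1144-c4-0`) for the crux `BaireTransfer.RobustLoudUpgrade`
# (stmt-AnomalousDissipation-1144): THE VISCOSITY UNFOLDING — skeleton v2 (after wave 1)

Companion of the generation-1 skeleton v5 (`Lines/malkin_cone_group_orbits.lean`), of c1 (`…_c1.lean`), c2 (`…_c2.lean`) and c3 (`…_c3.lean`).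
This file does NOT reshape those skeletons; its stubs were registered ADDITIVELY (`workitem stub-add`).  State after wave 1
(2026-08-16T22:5xZ) — EVERY registered stub of this companion except the residual is LANDED:

* `scaling_mem_loud` (sub-goal; loudness is scale-covariant): `Scaling.scaling_mem_loud` p127695 (`…StubScalingLoud.lean`, with `exists_scale_margin`);
* `stub_scalingCrossingClosure` (engine E′, steady): `ScalingCrossing.stub_scalingCrossingClosure` p128368;
* `stub_scalingCrossingClosurePeriodic` (engine E′, periodic): `ScalingCrossing.stub_scalingCrossingClosurePeriodic` p128316;
* `stub_radialSteady` (class R, steady; `LsFamily.stub_lsFamily` with border `f_c`): `ScalingCrossing.stub_radialSteady` p128334;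
* `stub_radialPeriodic` (class R, periodic; `LsFamilyPeriodic.stub_lsFamilyPeriodic` with border `f_c`): `ScalingCrossing.stub_radialPeriodic` p127986
  (+ generic `exists_ray_sign_change`, `hasDerivAt_along_ray`, `exists_sign_change_of_hasDerivAt`);
* definitions + glue `…LineScalingDefs.lean` p128623 (`scalingCrossingSteady/Periodic`, `radialSteady/Periodic`, `tameScaling`,
  `tameScaling_subset_closure_interior_loud`, registered `line_glue_c4`, registered sanity sub-goals `robustCrossing{Steady,Periodic}_subset_scalingCrossing{…}`).

Open: `stub_residual_c4` (crux-sized; the c3 residual `stub_residual_c3d` over `tamePeriodic4` implies it, `residual_c4_of_c3d`).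
-/

set_option linter.dupNamespace false

noncomputable section

open scoped BigOperators Topology
open Filter Set Function TopologicalSpace MeasureTheory

namespace Summit.AnomalousDissipation.AnomalousDissipation.Theorems.RobustLoudUpgrade

open Literature.Analysis.FunctionSpaces Literature.Analysis.FunctionSpaces.Torus
open Literature.Analysis.FluidPDE
open Summit.AnomalousDissipation.AnomalousDissipation.Theses.BaireTransfer

namespace ScalingCrossing

/-! ## §1 The landed stubs of the companion c4 (re-exported by name, for the record) -/

/-- `scaling_mem_loud` — LANDED p127695. [folklore] -/
theorem scaling_mem_loud' : ∀ (S : Finset (Fin 3 → ℤ)) (a a' E E' ε ε' α : ℝ) (c : Coeff S), c ∈ loud S a' E' ε' → 0 < α → α * a' ≤ a → α ^ 2 * E' ≤ E → ε ≤ α ^ 3 * ε' → α ^ 2 • c ∈ loud S a E ε :=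
  Scaling.scaling_mem_loud

/-- `scalingCrossingSteady ⊆ closure (interior LOUD)` (engine E′, steady) — LANDED p128368 / p128623. [folklore] -/
theorem scalingCrossingSteady_subset_closure_interior_loud' (S : Finset (Fin 3 → ℤ)) (a E ε : ℝ) :
    scalingCrossingSteady S a E ε ⊆ closure (interior (loud S a E ε)) :=
  scalingCrossingSteady_subset_closure_interior_loud S a E ε

/-- `scalingCrossingPeriodic ⊆ closure (interior LOUD)` (engine E′, periodic) — LANDED p128316 / p128623. [folklore] -/
theorem scalingCrossingPeriodic_subset_closure_interior_loud' (S : Finset (Fin 3 → ℤ)) (a E ε : ℝ) :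
    scalingCrossingPeriodic S a E ε ⊆ closure (interior (loud S a E ε)) :=
  scalingCrossingPeriodic_subset_closure_interior_loud S a E ε

/-- `radialSteady ⊆ scalingCrossingSteady` (class R, steady: fold in the Reynolds number) — LANDED p128334 / p128623. [folklore] -/
theorem radialSteady_subset_scalingCrossingSteady' (S : Finset (Fin 3 → ℤ)) (a E ε : ℝ) :
    radialSteady S a E ε ⊆ scalingCrossingSteady S a E ε :=
  radialSteady_subset_scalingCrossingSteady S a E ε

/-- `radialPeriodic ⊆ scalingCrossingPeriodic` (class R, periodic) — LANDED p127986 / p128623. [folklore] -/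
theorem radialPeriodic_subset_scalingCrossingPeriodic' (S : Finset (Fin 3 → ℤ)) (a E ε : ℝ) :
    radialPeriodic S a E ε ⊆ scalingCrossingPeriodic S a E ε :=
  radialPeriodic_subset_scalingCrossingPeriodic S a E ε

/-- `tameScaling ⊆ closure (interior LOUD)` — LANDED p128623. [folklore] -/
theorem tameScaling_subset_closure_interior_loud' (S : Finset (Fin 3 → ℤ)) (a E ε : ℝ) :
    tameScaling S a E ε ⊆ closure (interior (loud S a E ε)) :=
  tameScaling_subset_closure_interior_loud S a E ε

/-! ## §2 The one open stub: the residual (crux-sized) -/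

/-- **stub_residual_c4** (the residual of the companion c4; crux-sized = `stub_residual_c3d` with the scaling crossings and the radially
visible steady/periodic degeneracies moved to the tame side).  For `S ⊇ unitStock` every loud force is a limit in `P_S` of forces carrying a
TAME relaxed-loud witness of `tameScaling` at budgets `(2E, ε/2)`.  Open content: radially INvisible ghosts (`A u₀ ∈ range L`, σ one-signed
near `(c, 0)` on force × state space), steady kernels of dimension ≥ 2 / free-period kernels ≥ 3, continua neither generated by the lattice
flow nor unfolded by ν, drifting (non-mean-zero) degenerate witnesses. [folklore] -/
theorem stub_residual_c4 :
    ∀ S : Finset (Fin 3 → ℤ), unitStock ⊆ S → ∀ (a E ε : ℝ), 0 < a → 0 < ε →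
      loud S a E ε ⊆ closure (tameScaling S a (2 * E) (ε / 2)) := by
  sorry

/-- The reshape c3d → c4 only WEAKENS the residual: the c3 residual over `tamePeriodic4` implies the c4 residual. [folklore] -/
theorem residual_c4_of_c3d
    (h : ∀ S : Finset (Fin 3 → ℤ), unitStock ⊆ S → ∀ (a E ε : ℝ), 0 < a → 0 < ε →
      loud S a E ε ⊆ closure (tamePeriodic4 S a (2 * E) (ε / 2))) :
    ∀ S : Finset (Fin 3 → ℤ), unitStock ⊆ S → ∀ (a E ε : ℝ), 0 < a → 0 < ε →
      loud S a E ε ⊆ closure (tameScaling S a (2 * E) (ε / 2)) :=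
  fun S hS a E ε ha hε => (h S hS a E ε ha hε).trans
    (closure_mono (((Set.subset_union_left.trans Set.subset_union_left).trans Set.subset_union_left).trans
      Set.subset_union_left))

/-! ## §3 Composition (sorry-free): the crux BY NAME -/

/-- **Composition (companion c4): the registered stubs prove the crux `RobustLoudUpgrade` BY NAME** — `line_glue_c4` (LineScalingDefs)
applied to the residual. [folklore] -/
theorem RobustLoudUpgrade_of : RobustLoudUpgrade :=
  line_glue_c4 stub_residual_c4

end ScalingCrossing

end Summit.AnomalousDissipation.AnomalousDissipation.Theorems.RobustLoudUpgrade

end
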